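import Summits.ResolutionOfSingularities.ResolutionOfSingularities.Theorems.FrobeniusLadderFInjectiveMacaulayficationSliceableCentre
import Literature.AlgebraicGeometry.Resolution.Blowups
import Literature.AlgebraicGeometry.Resolution.QuasiExcellentSchemes
import HarnessLib

/-!
# (L4) `LocalFullificationDimFour` — the candidate d = 4 RESIDUE of the crux: FULL-ification of a 4-dimensional local blow-up scheme that is
# regular off its closed fibre, by ONE blowing up supported in its singular locus
# (crux `FInjectiveMacaulayfication` stmt-ResolutionOfSingularities-15315, chain w45a; res-L1-w45a-plan-1 RULING R16.64 PROPOSAL «DIM-4 SLICE» +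
# R16.65 «GO NOW» after res-L1-w45a-tri-2's AUDIT 23:08:19Z (PASS: S; typing advice followed verbatim); statement owner res-L1-w45a-lead-1 g7,
# signature posted 23:09:39Z)

[OURS · L1 W4.5a] STATEMENT file (`--supports stmt-ResolutionOfSingularities-15315 --as helper`); ONE `Prop`-valued CANDIDATE statement of OURS
(`@[conjecture] def`, consumed only as a hypothesis; no instance, no notation, no named fact); replaces the role of NO printed item; NOT a statement
of the manuscript; AI-written (AI review is weaker than expert review).

WHY (the DIM-4 SLICE, plan-1 R16.64). THEOREM A(4) — Temkin 2008 Prop. 2.3.4 truncated at codimension 4 with Cossart–Piltant 2019 at the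
dimension-3 points (tree: `RegularOffCodimFourResidue.exists_isBlowup_regular_off_codimFour` p557070, `TerminationModClosedPoints` p583229,
`DesingularizationOffClosedPoints` p582779) — gives every integral 4-fold `X/k` ONE blowing up `X′ → X` (centre in `Sing X`) that is REGULAR off
the preimage of a FINITE set `F` of CLOSED points. Running Temkin's induction ONE MORE STAGE at the points `b ∈ F`, now in FULL currency
(domain ∧ Cohen–Macaulay ∧ Frobenius-closed parameter ideals — the crux's stalk clause) instead of regularity, needs exactly the local statement
below at `S′ := X′ ×_X Spec 𝒪_{X,b}` (a blowing up of `Spec 𝒪_{X,b}`, regular off its closed fibre); the spread of the local centre (Temkin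
Lemma 2.1.1, `exists_idealSheaf_extension_fromSpecStalk`) is supported in `f⁻¹(b)` (closed), so the steps at distinct `b ∈ F` do not interact and
nothing already cured is re-blown. Hence **crux|_{dim X ≤ 4} ⟸ {CP 1.1, R–G 081R, CP 4.4} ∧ (L4)** (res-L1-w45a-stub-2's `…FTemkinClosedPoints`,
lead-1's `…FInjectiveMacaulayficationDimFour`): (L4) is the honest d = 4 residue of the WHOLE crux, with no #4β / FC″ split.

SIZE / POSITION (tri-2 23:08:19Z). ≤ S_proj(4)+(BP)+081R: a resolution of the quasi-excellent 4-dimensional `S′` by a `Sing`-supported blowing up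
makes it regular, hence FULL. Strictly between the d = 4 closed core of #4β (`ClosedCentreRungs.ClosedCentreExistsDimGe4`, FULL currency at an
isolated bad closed point: the Cartier instance `I = ⊤` of (L4) is exactly «an isolated 4-dimensional singularity has a FULL one-blow-up model with
centre supported at the point») and local resolution in dimension 4; it MERGES (T3ᵃ′)|₄ (`AbsorbingStep.AbsorbingClosedPointStepNC`, the closed
residual points of hole #3) with that core into ONE local statement. SPLIT recorded for the instance programme: CM-half = Macaulayfication by a
blowing up supported in the non-CM locus [Kawasaki 2000; Česnavičius 2021 — known]; F-half = «F-injectivise a Cohen–Macaulay 4-dimensional `S′`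
that is regular off a closed fibre, keeping CM, by one fibre-supported blowing up» [OPEN] — res-L1-w45a-idea-2's closed-point engine rows (K2W/ROWC
one- and two-step FULL tests at Cartier points) are instances of the open half. JUNK CHECKS: `I ≠ ⊥` excludes `S′ = ∅`; `S′` regular ⇒ `𝓚 := ⊤`
(allowed: `⊤ ≠ ⊥`, `supp ⊤ = ∅`); `x` of local dimension 4 NON-closed (schemes of dimension ≥ 5) is covered verbatim and harmless; M1/M2 (plan-1's
junk rules) do not bite: no pinning, no prescribed power off a residual — the hypothesis is regularity off the closed fibre and the conclusion
constrains nothing off `supp 𝓚`. Why it does not extend the door beyond dimension 4 (record): after a loc-dim-4 NON-closed point is FULL-ified, a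
closed `b` in its closure sees FULL-but-singular points off the closed fibre of `S′_b`, and the step at `b` would need a centre inside the non-FULL
locus (Česnavičius-shaped FULL-ification, not ≤ S).
[candidate statement, OURS; cite: Temkin2008, Prop. 2.3.4 and Lemma 2.1.1 (shape); Kawasaki2000 / Cesnavicius2021 (CM-half, context only)]
-/

-- single-problem summit: the doubled namespace component is forced
set_option linter.dupNamespace false

noncomputable section

open AlgebraicGeometry CategoryTheory Literature.AlgebraicGeometry.Resolution TopologicalSpace IsLocalRing

namespace Summit.ResolutionOfSingularities.ResolutionOfSingularities.Theorems.FInjectiveMacaulayfication.LocalFullificationDimFour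

open Summit.ResolutionOfSingularities.ResolutionOfSingularities.Theorems.FInjectiveMacaulayfication

/-- [OURS · CANDIDATE statement, not a fact] **(L4) LOCAL FULL-IFICATION IN DIMENSION FOUR.** For a prime `p`, a field `k` of characteristic `p`,
an integral separated `k`-scheme `X` of finite type, a point `x ∈ X` with `dim 𝒪_{X,x} = 4`, and a blowing up `g : S′ → Spec 𝒪_{X,x}` along an
ideal sheaf `I ≠ ⊥` such that `S′` is REGULAR at every point off the closed fibre `g⁻¹(x)`: there is an ideal sheaf `𝓚 ≠ ⊥` on `S′`, supported in
the singular locus `S′ ∖ Reg S′` (so `𝓚 = ⊤` when `S′` is regular), such that EVERY blowing up `S″ → S′` along `𝓚` is FULL at EVERY point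
(`SliceableCentre.FullCl`: domain ∧ systems of parameters weakly regular ∧ parameter ideals Frobenius closed — the crux's stalk clause).
The d = 4 residue of the crux (plan-1 R16.64/R16.65): crux|_{dim ≤ 4} ⟸ Cossart–Piltant package ∧ (L4). Merges (T3ᵃ′)|₄ with the d = 4 closed
core of #4β; CM-half known (Kawasaki/Česnavičius), F-half open. [candidate statement, OURS; open] -/
@[conjecture] def LocalFullificationDimFour : Prop :=
  ∀ (p : ℕ), p.Prime → ∀ (k : Type) [Field k] [CharP k p]
    (X : Scheme.{0}) (f : X ⟶ Spec (.of k)),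
      IsSeparated f → LocallyOfFiniteType f → QuasiCompact f → IsIntegral X →
      ∀ x : X, ringKrullDim (X.presheaf.stalk x) = 4 →
      ∀ (S' : Scheme.{0}) (g : S' ⟶ Spec (X.presheaf.stalk x)) (I : (Spec (X.presheaf.stalk x)).IdealSheafData),
        I ≠ ⊥ → IsBlowup g I →
        (∀ s : S', g.base s ≠ closedPoint (X.presheaf.stalk x) → s ∈ Scheme.regularLocus S') →
        ∃ 𝓚 : S'.IdealSheafData, 𝓚 ≠ ⊥ ∧ (𝓚.support : Set S') ⊆ (Scheme.regularLocus S')ᶜ ∧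
          ∀ (S'' : Scheme.{0}) (π : S'' ⟶ S'), IsBlowup π 𝓚 →
            ∀ s : S'', SliceableCentre.FullCl p (S''.presheaf.stalk s)

end Summit.ResolutionOfSingularities.ResolutionOfSingularities.Theorems.FInjectiveMacaulayfication.LocalFullificationDimFour

end
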